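import Summits.QuantumFields.BalabanUV.Beta.GAN24.VHWordsZeroLattice

/-!
# `BalabanUV.Beta.GAN24.VHSlotProfile` — binder row G-an2-4 ∕ (CONV-C), W-slot CT-W, conservation law (C)∕(C)sym, step (L3) of this lineage's note
# `HOME/b2b-balaban-gan24-formalise-leaf-04/g65/CSYM-LEVEL0-KERNEL-BLUEPRINT.md` §6 («VH words: located open»): **THE RESUMMED BORDER SLOT IS A BLOCK-PERIODIC, COARSELY SUPPORTED
# MULTIPLIER-LEG PROFILE, and a two-face word `(P ∘ Y) ∘ Q_{u′}` with a no-ff-block left factor `P`, a middle kernel `Y` with ZERO mm column charge and such a slot `Q`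
# vanishes bond by bond** — the generic mechanism behind the `S^VH ⊗ S^VH` words of the dressed level-`j` source

NOT IN PRINT; OUR BOOKKEEPING ([folklore] `tsum` reindexing ∕ Fubini BY NAME over this lineage's `ExchangeSlotResum` ∕ `EEWordValue.fubini3` ∕ `VHWordsZeroLattice`, leaf-06's
`ResolventLegCharges.tsum_exp_coarse_le'`, an1∕an2's `AveragingContours.blk ∕ off ∕ blk_add_off`; G-an2-4 formalisation swarm, leaf prover `b2b-balaban-gan24-formalise-leaf-04`,
gen 66).  HONEST FRAMING (cell contract, verbatim): «discharging `BetaPertH` makes Bałaban's UV stability UNCONDITIONAL — a real constructive-QFT result; it is NOT the continuum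
limit and NOT the Clay problem.»  HONEST DEPENDENCY (verbatim): «continuum YM on T⁴ ⇐ BetaPertH ∧ nine spine estimates (0/9 proved); BetaPertH ⇐ (D1) ∧ (D4) ∧ CAP+tail; G-an2-4
gates asym, D1 and NE2/3/4.»

WHY (blueprint §4, INTENT 24's ledger of the 18 sector words): after `ExchangeSlotResum.hasSum_slot_word` the lattice-summed border slot `Q_{u′} = vertexOfK X̃♮ Lc S^VH ν u′` enters
only through `T(f, z) = Σ'_{(u′,w)} 𝟙f(w_β)·Q_{u′} z w f (inl β)`: for `f` a field leg it is `0` (no ff block), for `f = inr m` it is `Lc`-PERIODIC in `z` (joint block covariance —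
pure reindexing) and SUPPORTED on the coarse lattice (an1's packer puts multiplier legs at `Lc•ℤ^{d+1}` only).  Against such a profile, a kernel column `Σ'_z K(y₁,z)(g, inr m)·T(z)`
collapses to `T(0)·(Σ_{z′} K(y₁, Lc•z′)(g, inr m))` — a COARSE-LEG COLUMN CHARGE: `0` on `g = inr m′` ((S2c), `DressedStepFaceCharges.hasSum_dressedStep_col`), an exit-face profile
on `g = inl a`.  Hence the `S^VH ⊗ S^VH` words vanish bond by bond (this file's §2, instanced in the sequel), and the `S^E ⊗ S^VH` words reduce to face-weighted left currents (sequel).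

WHAT ([folklore]; generic `d`, blocking `N ≥ 1`; 0 `def`, 0 cited facts, 0 `def … : Prop`, 0 sorry): §1 (generic slot family `Q : Site → MKer` with block covariance ∕ coarse support,
`N`-periodic weight `ρ₂`) **`tsum_pair_slot_periodic`** (`T(f, z + N•s) = T(f, z)`), **`tsum_pair_slot_eq_zero_of_off`** (`off N z ≠ 0 ⇒ T(inr m, z) = 0`), `zsmul_injective`,
**`tsum_col_mul_profile`** (`Σ'_z K(y₁,z)(g, inr m)·T(z) = c·T(0)` when `HasSum (z′ ↦ K(y₁, N•z′)(g, inr m)) c`, `T` periodic and coarsely supported), `abs_tsum_pair_slot_le`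
(a uniform bound); §2 `comp_noFF_inl`, **`tsum_noFF_left_profile_right_word_eq_zero_of`**: for `P` bi-localised at one point with NO ff block, `Y` decaying with
`HasSum (z′ ↦ Y y₁ (N•z′) (inr m′) (inr m)) 0` (zero mm column charge), `Q_{u′}` bi-localised at `N•u′`, block-covariant, no ff block, inr-first-leg coarsely supported:
`Σ'_{u′} Σ'_{(y,w)} ρ₁(y)ρ₂(w)·((P ∘ Y) ∘ Q_{u′}) y w (inl α)(inl β) = 0`.  Asserts NO value of Bałaban's tables; discharges NOTHING of (C)sym ∕ (Q-D) ∕ (Q-D-rate) ∕ «T2Shape» ∕ «T2Drift» ∕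
(hW, hWall); NEVER «G-an2-4 closed» as (CONV-C); NOT D1, NOT `BetaPertH`, NOT continuum, NOT Clay.  2026-08-23; no existing file touched.
-/

noncomputable section

open Finset
open scoped BigOperators
open Literature.MathematicalPhysics.QuantumFieldTheory
open Literature.MathematicalPhysics.QuantumFieldTheory.Balaban1983to89
open Literature.MathematicalPhysics.QuantumFieldTheory.Balaban1983to89.Beta
open B12Sec2to5 (l1 l1_nonneg)
open ExpKernelCalculus (Site MKer comp shiftK Decays BiLoc Zl Zl_nonneg summable_exp_shift' tsum_exp_shift' l1_sub_symm)
open OneStepResolventKernel (Fib decays_mono biLoc_mono)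
open BalabanStepJetsSucc (biLoc_comp_right)
open AffineAveraging (box toSite)
open AveragingContours (blk off blk_add_off)
open Summit.QuantumFields.BalabanUV.Beta.GAN24.KernelLegCharges (summable_exp_coarse)
open Summit.QuantumFields.BalabanUV.Beta.GAN24.ResolventLegCharges (tsum_exp_coarse_le')
open Summit.QuantumFields.BalabanUV.Beta.GAN24.ExchangeSlotResum (hasSum_slot_word summable_pair_slot)
open Summit.QuantumFields.BalabanUV.Beta.GAN24.EEWordValue (fubini3)

namespace Summit.QuantumFields.BalabanUV.Beta.GAN24.VHSlotProfile

variable {d : ℕ} {N : ℕ} [NeZero N]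

/-! ## §1 The resummed slot as a block-periodic, coarsely supported profile -/

section Profile

variable {Q : Site (d + 1) → MKer (d + 1) (Fib d)} {ρ₂ : Site (d + 1) → ℝ}

omit [NeZero N] in
/-- [folklore] **THE RESUMMED SLOT IS BLOCK-PERIODIC**: if `Q (u + s) = shiftK (−N•s) (Q u)` and `ρ₂` is `N`-periodic, then
`Σ'_{(u,w)} ρ₂(w)·Q u (z + N•s) w f b = Σ'_{(u,w)} ρ₂(w)·Q u z w f b` (reindexing `(u,w) ↦ (u + s, w + N•s)`; no summability). -/
theorem tsum_pair_slot_periodic (hQcov : ∀ u s : Site (d + 1), Q (u + s) = shiftK (-((N : ℤ) • s)) (Q u))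
    (hρ₂ : ∀ w s : Site (d + 1), ρ₂ (w + (N : ℤ) • s) = ρ₂ w) (z s : Site (d + 1)) (f b : Fib d) :
    ∑' uw : Site (d + 1) × Site (d + 1), ρ₂ uw.2 * Q uw.1 (z + (N : ℤ) • s) uw.2 f b = ∑' uw : Site (d + 1) × Site (d + 1), ρ₂ uw.2 * Q uw.1 z uw.2 f b := by
  rw [← (Equiv.addRight ((s, (N : ℤ) • s) : Site (d + 1) × Site (d + 1))).tsum_eq
    (fun uw : Site (d + 1) × Site (d + 1) => ρ₂ uw.2 * Q uw.1 (z + (N : ℤ) • s) uw.2 f b)]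
  refine tsum_congr fun uw => ?_
  show ρ₂ (uw.2 + (N : ℤ) • s) * Q (uw.1 + s) (z + (N : ℤ) • s) (uw.2 + (N : ℤ) • s) f b = ρ₂ uw.2 * Q uw.1 z uw.2 f b
  rw [hρ₂, hQcov]
  simp only [shiftK, add_neg_cancel_right]

omit [NeZero N] in
/-- [folklore] **THE RESUMMED SLOT IS COARSELY SUPPORTED ON ITS MULTIPLIER LEG**: if every `Q u z w (inr m) b` vanishes for `z` off the coarse lattice (`off N z ≠ 0`), so does
`Σ'_{(u,w)} ρ₂(w)·Q u z w (inr m) b`. -/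
theorem tsum_pair_slot_eq_zero_of_off (hQsupp : ∀ (u z w : Site (d + 1)) (m : Fin (d + 1)) (b : Fib d), off N z ≠ 0 → Q u z w (Sum.inr m) b = 0)
    (ρ₂ : Site (d + 1) → ℝ) {z : Site (d + 1)} (hz : off N z ≠ 0) (m : Fin (d + 1)) (b : Fib d) :
    ∑' uw : Site (d + 1) × Site (d + 1), ρ₂ uw.2 * Q uw.1 z uw.2 (Sum.inr m) b = 0 := by
  simp only [hQsupp _ _ _ m b hz, mul_zero, tsum_zero]

/-- [folklore] `z′ ↦ N•z′` is injective on `ℤ^{d+1}` (`N ≥ 1`). -/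
theorem zsmul_injective : Function.Injective fun z' : Site (d + 1) => (N : ℤ) • z' := by
  intro a b h
  have hN : (N : ℤ) ≠ 0 := by exact_mod_cast NeZero.ne N
  funext i
  have hi := congrFun h i
  simp only [Pi.smul_apply, smul_eq_mul] at hi
  exact mul_left_cancel₀ hN hi

/-- [folklore] **A KERNEL COLUMN AGAINST A PERIODIC, COARSELY SUPPORTED PROFILE COLLAPSES TO ITS COARSE-LEG CHARGE**: if `HasSum (z′ ↦ K y₁ (N•z′) g (inr m)) c`, `T (z + N•s) = T z`
and `T z = 0` off the coarse lattice, then `Σ'_z K y₁ z g (inr m)·T z = c·T 0` (`Function.Injective.tsum_eq` on the coarse sublattice). -/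
theorem tsum_col_mul_profile {K : MKer (d + 1) (Fib d)} {c : ℝ} {g : Fib d} {m : Fin (d + 1)} {y₁ : Site (d + 1)}
    (hcol : HasSum (fun z' : Site (d + 1) => K y₁ ((N : ℤ) • z') g (Sum.inr m)) c)
    {T : Site (d + 1) → ℝ} (hTper : ∀ z s : Site (d + 1), T (z + (N : ℤ) • s) = T z) (hTsupp : ∀ z : Site (d + 1), off N z ≠ 0 → T z = 0) :
    ∑' z : Site (d + 1), K y₁ z g (Sum.inr m) * T z = c * T 0 := by
  have hN : 1 ≤ N := Nat.one_le_iff_ne_zero.2 (NeZero.ne N)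
  have hsupp : Function.support (fun z : Site (d + 1) => K y₁ z g (Sum.inr m) * T z) ⊆ Set.range (fun z' : Site (d + 1) => (N : ℤ) • z') := by
    intro z hz
    by_contra hnot
    apply hz
    have hoff : off N z ≠ 0 := by
      intro h0
      apply hnot
      refine ⟨blk N z, ?_⟩
      have h := blk_add_off hN z
      have ht : toSite (0 : Fin (d + 1) → ℕ) = (0 : Site (d + 1)) := by
        funext i; simp [toSite]
      rw [h0, ht, add_zero] at h
      exact h
    show K y₁ z g (Sum.inr m) * T z = 0
    rw [hTsupp z hoff, mul_zero]
  rw [← (zsmul_injective (N := N)).tsum_eq hsupp]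
  have hT0 : ∀ z' : Site (d + 1), T ((N : ℤ) • z') = T 0 := fun z' => by
    have h := hTper 0 z'
    rwa [zero_add] at h
  simp only [hT0]
  rw [tsum_mul_right, hcol.tsum_eq]

/-- [folklore] **A UNIFORM BOUND ON THE RESUMMED SLOT**: `|Σ'_{(u,w)} ρ₂(w)·Q u z w f b| ≤ CQ·e^{δN(d+1)}·Zl(δ)²` for `Q u` bi-localised at `N•u` at rate `δ` and `|ρ₂| ≤ 1`
(leaf-06's `ResolventLegCharges.tsum_exp_coarse_le'`). -/
theorem abs_tsum_pair_slot_le {CQ δ : ℝ} (hδ : 0 < δ) (hQ : ∀ u, BiLoc (Q u) ((N : ℤ) • u) ((N : ℤ) • u) CQ δ) (h₂ : ∀ w, |ρ₂ w| ≤ 1)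
    (z : Site (d + 1)) (f b : Fib d) :
    |∑' uw : Site (d + 1) × Site (d + 1), ρ₂ uw.2 * Q uw.1 z uw.2 f b| ≤ CQ * (Real.exp (δ * ((N : ℝ) * (d + 1))) * Zl (d + 1) δ) * Zl (d + 1) δ := by
  have hN : 1 ≤ N := Nat.one_le_iff_ne_zero.2 (NeZero.ne N)
  have hCQ : 0 ≤ CQ := (hQ 0).nonneg b
  set M : Site (d + 1) × Site (d + 1) → ℝ := fun uw => CQ * Real.exp (-δ * l1 (z - (N : ℤ) • uw.1)) * Real.exp (-δ * l1 (uw.2 - (N : ℤ) • uw.1)) with hM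
  have hpt : ∀ uw : Site (d + 1) × Site (d + 1), |ρ₂ uw.2 * Q uw.1 z uw.2 f b| ≤ M uw := by
    intro uw
    rw [abs_mul]
    have hq := hQ uw.1 z uw.2 f b
    rw [mul_add, Real.exp_add, ← mul_assoc] at hq
    calc |ρ₂ uw.2| * |Q uw.1 z uw.2 f b| ≤ 1 * (CQ * Real.exp (-δ * l1 (z - (N : ℤ) • uw.1)) * Real.exp (-δ * l1 (uw.2 - (N : ℤ) • uw.1))) :=
          mul_le_mul (h₂ uw.2) hq (abs_nonneg _) zero_le_one
      _ = M uw := by simp only [hM, one_mul]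
  have hM0 : 0 ≤ M := fun uw => by positivity
  have hMs : Summable M := by
    refine (summable_prod_of_nonneg hM0).2 ⟨fun u => ?_, ?_⟩
    · exact (summable_exp_shift' hδ ((N : ℤ) • u)).mul_left (CQ * Real.exp (-δ * l1 (z - (N : ℤ) • u)))
    · simp only [hM]
      simp_rw [tsum_mul_left, tsum_exp_shift']
      have hs : Summable fun u : Site (d + 1) => Real.exp (-δ * l1 (z - (N : ℤ) • u)) := by
        have h := summable_exp_coarse (d := d) hN hδ z
        exact h.congr fun u => by rw [l1_sub_symm]
      exact (hs.mul_left CQ).mul_right _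
  have hS : Summable fun uw : Site (d + 1) × Site (d + 1) => ρ₂ uw.2 * Q uw.1 z uw.2 f b :=
    Summable.of_norm_bounded hMs (fun uw => by rw [Real.norm_eq_abs]; exact hpt uw)
  calc |∑' uw : Site (d + 1) × Site (d + 1), ρ₂ uw.2 * Q uw.1 z uw.2 f b|
      ≤ ∑' uw : Site (d + 1) × Site (d + 1), M uw := by
        rw [← Real.norm_eq_abs]
        exact tsum_of_norm_bounded hMs.hasSum (fun uw => by rw [Real.norm_eq_abs]; exact hpt uw)
    _ = ∑' u : Site (d + 1), ∑' w : Site (d + 1), M (u, w) := hMs.tsum_prod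
    _ = ∑' u : Site (d + 1), CQ * Real.exp (-δ * l1 (z - (N : ℤ) • u)) * Zl (d + 1) δ := by
        refine tsum_congr fun u => ?_
        simp only [hM]
        rw [tsum_mul_left, tsum_exp_shift']
    _ = CQ * (∑' u : Site (d + 1), Real.exp (-δ * l1 (z - (N : ℤ) • u))) * Zl (d + 1) δ := by
        rw [tsum_mul_right, tsum_mul_left]
    _ ≤ CQ * (Real.exp (δ * ((N : ℝ) * (d + 1))) * Zl (d + 1) δ) * Zl (d + 1) δ := by
        have h := tsum_exp_coarse_le' (d := d) N hδ z
        have hZ : 0 ≤ Zl (d + 1) δ := Zl_nonneg hδ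
        exact mul_le_mul_of_nonneg_right (mul_le_mul_of_nonneg_left h hCQ) hZ

end Profile

/-! ## §2 A two-face word with a no-ff-block left factor, a middle kernel of zero mm column charge and a border slot: zero, bond by bond -/

section Word

variable {P Y : MKer (d + 1) (Fib d)} {Q : Site (d + 1) → MKer (d + 1) (Fib d)} {p : Site (d + 1)} {CP CY CQ CA δ : ℝ} {ρ₁ ρ₂ : Site (d + 1) → ℝ} {α β : Fin (d + 1)}

omit [NeZero N] in
/-- [folklore] The entries of `P ∘ Y` on a field first leg run through multiplier middle legs only when `P` has no ff block (any second leg). -/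
theorem comp_noFF_inl (hPff : ∀ (y z : Site (d + 1)) (α' a : Fin (d + 1)), P y z (Sum.inl α') (Sum.inl a) = 0) (y z : Site (d + 1)) (α' : Fin (d + 1)) (g : Fib d) :
    comp P Y y z (Sum.inl α') g = ∑' y₁ : Site (d + 1), ∑ m : Fin (d + 1), P y y₁ (Sum.inl α') (Sum.inr m) * Y y₁ z (Sum.inr m) g := by
  simp only [comp, Fintype.sum_sum_type, hPff, zero_mul, Finset.sum_const_zero, zero_add]

/-- [folklore] **A TWO-FACE WORD `(P ∘ Y) ∘ Q_{u′}` SUMMED OVER THE BORDER BOND `u′` VANISHES** when: `P` is bi-localised at one point and has NO ff block; `Y` decays and has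
ZERO mm COLUMN CHARGE (`HasSum (z′ ↦ Y y₁ (N•z′) (inr m′) (inr m)) 0`); the slot `Q_{u′}` is bi-localised at `N•u′`, block-covariant, has no ff block and its inr-first-leg entries are
supported on the coarse lattice; the weights are bounded by `1` and `ρ₂` is `N`-periodic — all at ONE rate `δ`.  ROUTE: `ExchangeSlotResum.hasSum_slot_word`; field middle legs see the slot's
(vanishing) ff block; multiplier middle legs see the profile `T(inr m, ·)` of §1, bounded (`abs_tsum_pair_slot_le`), so `EEWordValue.fubini3` regroups the word as
`Σ'_{y₁} Σ_{m′} (Σ'_y ρ₁·P(y,y₁)(α, inr m′))·(Σ'_z Y y₁ z (inr m′)(inr m)·T(inr m, z))`, whose last factor is `0·T(0)` (`tsum_col_mul_profile`). -/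
theorem tsum_noFF_left_profile_right_word_eq_zero_of (hδ : 0 < δ) (hP : BiLoc P p p CP δ)
    (hPff : ∀ (y z : Site (d + 1)) (α' a : Fin (d + 1)), P y z (Sum.inl α') (Sum.inl a) = 0)
    (hY : Decays Y CY δ) (hYmm : ∀ (y₁ : Site (d + 1)) (m m' : Fin (d + 1)), HasSum (fun z' : Site (d + 1) => Y y₁ ((N : ℤ) • z') (Sum.inr m') (Sum.inr m)) 0)
    (hA : BiLoc (comp P Y) p p CA δ)
    (hQ : ∀ u, BiLoc (Q u) ((N : ℤ) • u) ((N : ℤ) • u) CQ δ) (hQcov : ∀ u s : Site (d + 1), Q (u + s) = shiftK (-((N : ℤ) • s)) (Q u))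
    (hQff : ∀ (u z w : Site (d + 1)) (b' b : Fin (d + 1)), Q u z w (Sum.inl b') (Sum.inl b) = 0)
    (hQsupp : ∀ (u z w : Site (d + 1)) (m : Fin (d + 1)) (b : Fib d), off N z ≠ 0 → Q u z w (Sum.inr m) b = 0)
    (h₁ : ∀ y, |ρ₁ y| ≤ 1) (h₂ : ∀ w, |ρ₂ w| ≤ 1) (hρ₂ : ∀ w s : Site (d + 1), ρ₂ (w + (N : ℤ) • s) = ρ₂ w) :
    ∑' u' : Site (d + 1), ∑' yw : Site (d + 1) × Site (d + 1), ρ₁ yw.1 * ρ₂ yw.2 * comp (comp P Y) (Q u') yw.1 yw.2 (Sum.inl α) (Sum.inl β) = 0 := by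
  classical
  have hCP : 0 ≤ CP := hP.nonneg (Sum.inl 0)
  have hCY : 0 ≤ CY := hY.nonneg (Sum.inl 0)
  have hCQ : 0 ≤ CQ := (hQ 0).nonneg (Sum.inl 0)
  -- step 1: resum the border slot
  rw [(hasSum_slot_word (N := N) (A := comp P Y) (Q := Q) hδ hA hQ h₁ h₂ (Sum.inl α) (Sum.inl β)).tsum_eq, Fintype.sum_sum_type]
  -- step 2: field middle legs: the slot has no ff block
  have hinl : ∀ b' : Fin (d + 1), (∑' yz : Site (d + 1) × Site (d + 1), ρ₁ yz.1 * comp P Y yz.1 yz.2 (Sum.inl α) (Sum.inl b') *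
      ∑' uw : Site (d + 1) × Site (d + 1), ρ₂ uw.2 * Q uw.1 yz.2 uw.2 (Sum.inl b') (Sum.inl β)) = 0 := by
    intro b'
    simp only [hQff, mul_zero, tsum_zero]
  simp only [hinl, Finset.sum_const_zero, zero_add]
  -- step 3: multiplier middle legs: the profile, `fubini3`, the mm column charge
  set T : Fin (d + 1) → Site (d + 1) → ℝ := fun m z => ∑' uw : Site (d + 1) × Site (d + 1), ρ₂ uw.2 * Q uw.1 z uw.2 (Sum.inr m) (Sum.inl β) with hT
  have hfold : ∀ (m : Fin (d + 1)) (z : Site (d + 1)), (∑' uw : Site (d + 1) × Site (d + 1), ρ₂ uw.2 * Q uw.1 z uw.2 (Sum.inr m) (Sum.inl β)) = T m z := fun m z => rfl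
  simp only [hfold]
  have hTb : ∀ (m : Fin (d + 1)) (z : Site (d + 1)), |T m z| ≤ CQ * (Real.exp (δ * ((N : ℝ) * (d + 1))) * Zl (d + 1) δ) * Zl (d + 1) δ :=
    fun m z => abs_tsum_pair_slot_le (N := N) hδ hQ h₂ z (Sum.inr m) (Sum.inl β)
  have hM : 0 ≤ CQ * (Real.exp (δ * ((N : ℝ) * (d + 1))) * Zl (d + 1) δ) * Zl (d + 1) δ := by
    have hZ : 0 ≤ Zl (d + 1) δ := Zl_nonneg hδ
    positivity
  have e3 : ∀ m : Fin (d + 1), (∑' yz : Site (d + 1) × Site (d + 1), ρ₁ yz.1 * comp P Y yz.1 yz.2 (Sum.inl α) (Sum.inr m) * T m yz.2) =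
      ∑' yz : Site (d + 1) × Site (d + 1), ρ₁ yz.1 * (∑' y₁ : Site (d + 1), ∑ m' : Fin (d + 1), P yz.1 y₁ (Sum.inl α) (Sum.inr m') * Y y₁ yz.2 (Sum.inr m') (Sum.inr m)) * T m yz.2 :=
    fun m => tsum_congr fun yz => by rw [comp_noFF_inl hPff]
  simp only [e3]
  rw [fubini3 (ι := Fin (d + 1)) (f := ρ₁) (V := fun y y₁ m' => P y y₁ (Sum.inl α) (Sum.inr m')) (X := fun y₁ z m' m => Y y₁ z (Sum.inr m') (Sum.inr m))
    (T := T) (c := p) hδ hCP hCY hM h₁ (fun y y₁ m' => hP y y₁ (Sum.inl α) (Sum.inr m')) (fun y₁ z m' m => hY y₁ z (Sum.inr m') (Sum.inr m)) hTb]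
  have hkill : ∀ (y₁ : Site (d + 1)) (m' : Fin (d + 1)), (∑' z : Site (d + 1), ∑ m : Fin (d + 1), Y y₁ z (Sum.inr m') (Sum.inr m) * T m z) = 0 := by
    intro y₁ m'
    have hs : ∀ m : Fin (d + 1), Summable fun z : Site (d + 1) => Y y₁ z (Sum.inr m') (Sum.inr m) * T m z := by
      intro m
      refine Summable.of_norm_bounded (((ExpKernelCalculus.summable_exp_shift hδ y₁).mul_left CY).mul_right
        (CQ * (Real.exp (δ * ((N : ℝ) * (d + 1))) * Zl (d + 1) δ) * Zl (d + 1) δ)) (fun z => ?_)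
      rw [Real.norm_eq_abs, abs_mul]
      exact mul_le_mul (hY y₁ z (Sum.inr m') (Sum.inr m)) (hTb m z) (abs_nonneg _) (by positivity)
    rw [Summable.tsum_finsetSum (fun m _ => hs m)]
    refine Finset.sum_eq_zero fun m _ => ?_
    rw [tsum_col_mul_profile (N := N) (hYmm y₁ m m') (fun z s => tsum_pair_slot_periodic (N := N) hQcov hρ₂ z s (Sum.inr m) (Sum.inl β))
      (fun z hz => tsum_pair_slot_eq_zero_of_off (N := N) hQsupp ρ₂ hz m (Sum.inl β)), zero_mul]
  simp only [hkill, mul_zero, Finset.sum_const_zero, tsum_zero]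

end Word

end Summit.QuantumFields.BalabanUV.Beta.GAN24.VHSlotProfile

end
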